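import Literature.Algebra.EuclideanLattices.SuccessiveMinima
import HarnessLib

/-!
# The minimum distance of a lattice as a point-to-set distance (Cassels VIII §1, eq. (4))

Trunk: Lattice (`Algebra/EuclideanLattices`). Theorems-only companion file of
`Literature/Algebra/EuclideanLattices/SuccessiveMinima.lean`, discharging the named fact
`Literature.Algebra.EuclideanLattices.minNorm_eq_infDist` by `Literature.Algebra.EuclideanLattices.minNorm_eq_infDist_holds`: for every
`ℤ`-submodule `L` of a real normed group, `minNorm L`, the infimum of the norms of the nonzero
vectors of `L`, equals `Metric.infDist 0 (L ∖ {0})`, junk values included (both are `0` for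
`L = ⊥`). (Kept separate from `SuccessiveMinimaProofs.lean`, which discharges other facts of the
same file; this file imports only `SuccessiveMinima.lean`.)

## Source

Cassels, *An Introduction to the Geometry of Numbers* (Springer Classics in Mathematics, 1997
reprint of the 1971 edition). For a distance function `F` and a lattice `Λ`, Ch. IV §4, eq. (1)
defines the lattice minimum `F(Λ) = inf {F(a) : a ∈ Λ, a ≠ o}`; Ch. VIII §1 (pp. 201–202) defines
the successive minima `λ_k(F, Λ)` and records, eq. (4), "In the notation of §4 of Chapter IV we
have `λ₁ = F(Λ) = inf_{a ∈ Λ, a ≠ o} F(a)`". For the Euclidean distance function `F(x) = |x|`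
this infimum is the distance from the origin `o` to the set `Λ ∖ {o}`, which is what the vendored
fact expresses with Mathlib's `Metric.infDist`; the identity is definitional (no discreteness,
completeness or finite-dimensionality is used), and both sides take the junk value `0` when
`Λ ∖ {o}` is empty (`Real.sInf_empty`, `Metric.infDist_empty`).

## Proof

The set `{x | x ∈ L ∧ x ≠ 0}` whose norms define `minNorm L` is definitionally `(L : Set E) ∖ {0}`;
`Metric.infDist_eq_iInf` rewrites `Metric.infDist 0 s` as `⨅ y : s, dist 0 y` (valid also for
`s = ∅`), `sInf_image'` rewrites `sInf (‖·‖ '' s)` as `⨅ y : s, ‖y‖`, and `dist 0 y = ‖y‖`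
(`dist_zero_left`).

## References

* J. W. S. Cassels, *An Introduction to the Geometry of Numbers*, Classics in Mathematics,
  Springer (1997, reprint of the 1971 edition), Ch. IV §4 eq. (1) (the lattice minimum `F(Λ)`),
  Ch. VIII §1 (successive minima, pp. 201–202), eq. (4) (`λ₁ = F(Λ)`). [cite: Cassels1997]
-/

noncomputable section

open Metric

namespace Literature.Algebra.EuclideanLattices

variable {E : Type*} [NormedAddCommGroup E]

/-- Discharge of `minNorm_eq_infDist`: for every `ℤ`-submodule `L` of a real normed group,
`minNorm L = Metric.infDist 0 (L ∖ {0})`, junk values included (both sides are `0` when `L = ⊥`: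
`sInf ∅ = 0` in `ℝ`, resp. `Metric.infDist_empty`); no discreteness is needed for this
definitional identity. Proof: the set `{x | x ∈ L ∧ x ≠ 0}` whose norms define `minNorm L` is
definitionally `(L : Set E) ∖ {0}`; `Metric.infDist_eq_iInf` rewrites the right-hand side as
`⨅ y : L ∖ {0}, dist 0 y` (valid also for the empty set), `sInf_image'` rewrites the left-hand
side as `⨅ y : L ∖ {0}, ‖y‖`, and `dist 0 y = ‖y‖` (`dist_zero_left`).
Source: Cassels writes `F(Λ) = inf {F(a) : a ∈ Λ, a ≠ o}` for a distance function `F` and a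
lattice `Λ` (Ch. IV §4, eq. (1)) and records `λ₁ = F(Λ)` for the first successive minimum
(Ch. VIII §1, eq. (4), pp. 201–202); for the Euclidean distance `F(x) = |x|` this infimum is the
distance from `o` to `Λ ∖ {o}`, which is what the present lemma expresses with Mathlib's
`Metric.infDist`. [cite: Cassels1997, Ch. VIII §1 eq. (4) and Ch. IV §4 eq. (1)] -/
theorem minNorm_eq_infDist_holds : minNorm_eq_infDist (E := E) := by
  intro L
  have hset : {x : E | x ∈ L ∧ x ≠ 0} = (L : Set E) \ {0} := rfl
  rw [minNorm, hset, infDist_eq_iInf, sInf_image']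
  simp only [dist_zero_left]

end Literature.Algebra.EuclideanLattices
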